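import Literature.Topology.FourManifolds.HomotopySpheresGroup
import Literature.Topology.FourManifolds.OrientedConnectedSumTransportProofs
import Literature.Topology.FourManifolds.OrientedConnectedSumExistence
import Literature.Topology.FourManifolds.HCobordism
import HarnessLib

/-!
# The group `Θₙ`: the class-level Lemma 2.1 from the manifold-level facts (proofs)

Sibling proofs file of `HomotopySpheresGroup.lean` (the decomposition of Kervaire–Milnor's
Theorem 1.1, named fact `Literature.Topology.FourManifolds.exists_commGroup_homotopySphereClass`). That file reduced the target
to the class-level package `HomotopySphereClass.GroupLawFacts n` and reduced three of its five
fields to manifold-level named facts, leaving the class-level uniqueness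
(`HomotopySphereClass.isMul_unique`, tree fact) and associativity
(`HomotopySphereClass.isMul_assoc`) of the relational connected sum `IsMul` on `Θₙ`. Here these
two are reduced as well, using the naturality of oriented connected sums in the summands
(`Literature.Topology.FourManifolds.IsOrientedConnectedSum.of_diffeomorph`, file `OrientedConnectedSumTransportProofs.lean`):

* `HomotopySphereClass.IsMul.exists_isOrientedConnectedSum_of_mk_eq` — a witness `(Σ, Σ', Σ'')`
  of `a # b = c` may be replaced by any other representatives of `a`, `b` (transport along the
  oriented diffeomorphisms given by `mk_eq_mk_iff_holds`);
* `HomotopySphereClass.isMul_unique_of` — `isMul_unique` in dimension `n ≠ 0` follows from the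
  Palais–Cerf uniqueness of oriented connected sums of connected oriented manifolds (tree fact
  `Literature.Topology.FourManifolds.exists_diffeomorph_isOrientationPreserving_of_isOrientedConnectedSum`, Kervaire–Milnor
  1963, Lemma 2.1 "well defined");
* `HomotopySphereClass.isMul_assoc_of` — `isMul_assoc` (which hypothesises `n ≠ 0`) follows from
  the manifold-level associativity `Literature.Topology.FourManifolds.isOrientedConnectedSum_assoc` (Kervaire–Milnor 1963,
  Lemma 2.1 "associative");
* `HomotopySphere.simplyConnectedSpace` (a homotopy `n`-sphere, `n ≥ 2`, is simply connected:
  `π₁(Sⁿ) = 1`, `Literature.Topology.FourManifolds.simplyConnectedSpace_euclideanSphere`, and homotopy invariance of simple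
  connectivity) and `HomotopySphere.nonempty_diffeomorph_of_isHCobordant`: h-cobordant homotopy
  `n`-spheres, `n ≥ 5`, are diffeomorphic, GIVEN the smooth h-cobordism theorem in the form of
  the tree fact `Literature.Topology.FourManifolds.nonempty_diffeomorph_of_isHCobordant_of_five_le` (`HCobordism.lean`,
  **spc4.S15**; Smale 1962, Cor. 1.3; Kervaire–Milnor 1963, p. 505);
* `HomotopySphereClass.groupLawFacts_of_manifoldFacts` and
  `Literature.Topology.FourManifolds.exists_commGroup_homotopySphereClass_of_manifoldFacts` — **Kervaire–Milnor's Theorem 1.1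
  for `Θₙ`, `n ≠ 0, 4`, from manifold-level named facts only**: (i) homotopy spheres of
  dimension `≤ 3` are standard (p. 507 + Perelman; tree fact spc4.S32), (iii) sums of homotopy
  spheres are homotopy spheres (p. 505), (iv) Palais–Cerf uniqueness and (v) associativity and
  (vi) `M # Sⁿ = M` (Lemma 2.1), (vii) `Σ # (-Σ) ∼ₕ Sⁿ` (Lemmas 2.3–2.4), (viii) Smale's
  h-cobordism theorem (p. 505; spc4.S15). Each of these seven is a named fact of the tree with
  its own citation; (ii) existence of oriented connected sums (§2) is the tree THEOREM
  `Literature.Topology.FourManifolds.exists_isOrientedConnectedSum_holds` (`OrientedConnectedSumExistence.lean`) and is fed in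
  here; what remains of Theorem 1.1 beyond (i), (iii)–(viii) is proved.

## References

* M. Kervaire, J. Milnor, *Groups of homotopy spheres I*, Ann. of Math. (2) 77 (1963), 504–537:
  Thm 1.1 (p. 504), §2 pp. 505–507 (Lemmas 2.1–2.4, proof of Thm 1.1). doi:10.2307/1970128
  [KervaireMilnorAnnals1963]
* J. Milnor, *Lectures on the h-cobordism theorem*, Princeton (1965), Thm 9.1. [MilnorHCobordism1965]
* S. Smale, *On the structure of manifolds*, Amer. J. Math. 84 (1962), 387–399, Thm 1.1,
  Cor. 1.3. [Smale1962]
* A. Hatcher, *Algebraic Topology*, CUP (2002), Prop. 1.14 (`π₁(Sⁿ) = 1`, `n ≥ 2`). [HatcherAT2002]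
-/

open scoped Manifold ContDiff Topology ContinuousMap
open Set Module

noncomputable section

namespace Literature.Topology.FourManifolds

namespace HomotopySphere

variable {n : ℕ}

/-- **A homotopy `n`-sphere, `n ≥ 2`, is simply connected**: `π₁(Sⁿ) = 1` for `n ≥ 2` (Hatcher,
*Algebraic Topology* (2002), Prop. 1.14; tree theorem `Literature.Topology.FourManifolds.simplyConnectedSpace_euclideanSphere`)
and simple connectivity is a homotopy invariant (Mathlib's
`ContinuousMap.HomotopyEquiv.simplyConnectedSpace`). Kervaire–Milnor 1963, §2, p. 506 use this in
Lemma 2.3 ("A simply connected manifold `M` is h-cobordant to the sphere …").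
[cite: HatcherAT2002, Prop. 1.14] -/
theorem simplyConnectedSpace (h2 : 2 ≤ n) (S : HomotopySphere n) :
    SimplyConnectedSpace S.carrier := by
  obtain ⟨e⟩ := S.nonempty_homotopyEquiv
  haveI := simplyConnectedSpace_euclideanSphere h2
  exact e.simplyConnectedSpace

/-- **h-cobordant homotopy `n`-spheres, `n ≥ 5`, are diffeomorphic**, GIVEN the smooth
h-cobordism theorem in the form of the tree fact `SPC4.nonempty_diffeomorph_of_isHCobordant_of_five_le`
(spc4.S15; Smale, *On the structure of manifolds* (1962), Cor. 1.3; Milnor, *Lectures on the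
h-cobordism theorem* (1965), Thm 9.1): homotopy spheres are closed and simply connected
(`HomotopySphere.simplyConnectedSpace`). This is the remark of Kervaire–Milnor 1963, p. 505,
that `Θₙ` is the set of diffeomorphism classes for `n ≠ 3, 4`. [cite: Smale1962, Cor. 1.3] -/
theorem nonempty_diffeomorph_of_isHCobordant
    (hS15 : FourManifolds.nonempty_diffeomorph_of_isHCobordant_of_five_le.{0}) (h5 : 5 ≤ n)
    (U V : HomotopySphere n) (h : U.IsHCobordant V) :
    Nonempty (U.carrier ≃ₘ⟮𝓡 n, 𝓡 n⟯ V.carrier) := by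
  haveI := U.simplyConnectedSpace (by omega)
  exact hS15 h5 h

end HomotopySphere

namespace HomotopySphereClass

variable {n : ℕ}

/-- **Witnesses of `a # b = c` may use any representatives of `a` and `b`.** If `IsMul a b c` and
`Σ₁`, `Σ₂` are homotopy spheres with `[Σ₁] = a`, `[Σ₂] = b`, then some representative `Σ` of `c`
is an oriented connected sum `Σ₁ # Σ₂`: transport the given witness along the
orientation-preserving diffeomorphisms provided by `mk_eq_mk_iff_holds`
(`IsOrientedConnectedSum.of_diffeomorph`; Kervaire–Milnor 1963, Lemma 2.1, naturality of `#`
in the summands). [cite: KervaireMilnorAnnals1963, Lemma 2.1 (p. 505)] -/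
theorem IsMul.exists_isOrientedConnectedSum_of_mk_eq {a b c : HomotopySphereClass n}
    (h : IsMul a b c) {S' T' : HomotopySphere n} (hS : mk S' = a) (hT : mk T' = b) :
    ∃ U : HomotopySphere n, mk U = c ∧
      IsOrientedConnectedSum S'.orientation T'.orientation U.orientation := by
  obtain ⟨S, T, U, rfl, rfl, hU, hSTU⟩ := h
  obtain ⟨φ, hφ⟩ := mk_eq_mk_iff_holds.mp hS.symm
  obtain ⟨χ, hχ⟩ := mk_eq_mk_iff_holds.mp hT.symm
  exact ⟨U, hU, hSTU.of_diffeomorph φ hφ χ hχ⟩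

/-- **`isMul_unique` from the Palais–Cerf uniqueness of oriented connected sums** (`n ≠ 0`).
GIVEN the tree fact `exists_diffeomorph_isOrientationPreserving_of_isOrientedConnectedSum` for
homotopy `n`-spheres (Kervaire–Milnor 1963, Lemma 2.1, "well defined … up to orientation
preserving diffeomorphism", via the disc theorem of Palais and Cerf), the product in `Θₙ` is
unique: two witnesses of `a # b` are, after transport to common representatives of `a`, `b`
(`IsMul.exists_isOrientedConnectedSum_of_mk_eq`), two oriented connected sums of the same
connected oriented manifolds (`n ≠ 0`: homotopy `n`-spheres are connected).
[cite: KervaireMilnorAnnals1963, Lemma 2.1 (p. 505)] -/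
theorem isMul_unique_of (hn : n ≠ 0)
    (hPC : ∀ S T U U' : HomotopySphere n,
      exists_diffeomorph_isOrientationPreserving_of_isOrientedConnectedSum (IM := 𝓡 n)
        (IN := 𝓡 n) (IP := 𝓡 n) (IP' := 𝓡 n) (M := S.carrier) (N := T.carrier)
        (P := U.carrier) (P' := U'.carrier)) :
    isMul_unique (n := n) := by
  intro a b c c' h h'
  obtain ⟨S, T, U, rfl, rfl, rfl, hU⟩ := h
  obtain ⟨U', hc', hU'⟩ := h'.exists_isOrientedConnectedSum_of_mk_eq rfl rfl
  haveI := S.connectedSpace hn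
  haveI := T.connectedSpace hn
  obtain ⟨e, he⟩ := hPC S T U U' hU hU'
  rw [← hc']
  exact sound ⟨e, he⟩

/-- **`isMul_assoc` from the manifold-level associativity.** GIVEN
`isOrientedConnectedSum_assoc` (Kervaire–Milnor 1963, Lemma 2.1: `(M₁ # M₂) # M₃ ≅ M₁ # (M₂ # M₃)`
by an orientation-preserving diffeomorphism, for closed connected oriented manifolds), the
relational product on `Θₙ` is associative: transport the four witnesses to common
representatives (`IsMul.exists_isOrientedConnectedSum_of_mk_eq`) and apply the fact to the
homotopy spheres involved (closed, and connected as `n ≠ 0`).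
[cite: KervaireMilnorAnnals1963, Lemma 2.1 (p. 505)] -/
theorem isMul_assoc_of (hK2 : isOrientedConnectedSum_assoc.{0}) :
    isMul_assoc (n := n) := by
  intro hn a b c ab bc d d' h₁ h₂ h₃ h₄
  obtain ⟨S₁, S₂, U₁₂, rfl, rfl, rfl, h12⟩ := h₁
  obtain ⟨S₃, hc⟩ := mk_surjective c
  obtain ⟨U₂₃, hbc, h23⟩ := h₂.exists_isOrientedConnectedSum_of_mk_eq rfl hc
  obtain ⟨D, hd, hD⟩ := h₃.exists_isOrientedConnectedSum_of_mk_eq rfl hc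
  obtain ⟨D', hd', hD'⟩ := h₄.exists_isOrientedConnectedSum_of_mk_eq rfl hbc
  haveI := S₁.connectedSpace hn
  haveI := S₂.connectedSpace hn
  haveI := S₃.connectedSpace hn
  haveI := U₁₂.connectedSpace hn
  haveI := U₂₃.connectedSpace hn
  obtain ⟨e, he⟩ := hK2 n S₁.carrier S₂.carrier S₃.carrier U₁₂.carrier U₂₃.carrier D.carrier
    D'.carrier S₁.orientation S₂.orientation S₃.orientation U₁₂.orientation U₂₃.orientation
    D.orientation D'.orientation h12 hD h23 hD'
  rw [← hd, ← hd']
  exact sound ⟨e, he⟩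

/-- **`GroupLawFacts n` for `n ≥ 5` from manifold-level facts only** (Kervaire–Milnor 1963, §2):
sums of homotopy spheres are homotopy spheres (p. 505), Palais–Cerf uniqueness and
associativity of `#` (Lemma 2.1, via `isMul_unique_of`, `isMul_assoc_of`), `M # Sⁿ = M`
(Lemma 2.1), `Σ # (-Σ) ∼ₕ Sⁿ` (Lemmas 2.3–2.4) and Smale's h-cobordism theorem (p. 505; tree
fact `SPC4.nonempty_diffeomorph_of_isHCobordant_of_five_le`, spc4.S15, through
`HomotopySphere.nonempty_diffeomorph_of_isHCobordant`); existence of oriented connected sums is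
the theorem `exists_isOrientedConnectedSum_holds`.
[cite: KervaireMilnorAnnals1963, §2 (Lemmas 2.1–2.4, pp. 505–507)] -/
theorem groupLawFacts_of_manifoldFacts (h5 : 5 ≤ n)
    (hK1 : HomotopySphere.nonempty_homotopyEquiv_sphere_of_isConnectedSum)
    (hPC : ∀ S T U U' : HomotopySphere n,
      exists_diffeomorph_isOrientationPreserving_of_isOrientedConnectedSum (IM := 𝓡 n)
        (IN := 𝓡 n) (IP := 𝓡 n) (IP' := 𝓡 n) (M := S.carrier) (N := T.carrier)
        (P := U.carrier) (P' := U'.carrier))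
    (hK2 : isOrientedConnectedSum_assoc.{0})
    (hK3 : isOrientedConnectedSum_sphere_self.{0})
    (hK4 : HomotopySphere.isHCobordant_sphere_of_isOrientedConnectedSum_neg)
    (hS15 : FourManifolds.nonempty_diffeomorph_of_isHCobordant_of_five_le.{0}) :
    GroupLawFacts n := by
  have hn : n ≠ 0 := by omega
  obtain ⟨o₀⟩ := (isOrientable_sphere_holds n : Nonempty _)
  exact
    { exists_isMul := exists_isMul_of exists_isOrientedConnectedSum_holds hK1 hn
      isMul_unique := fun _ _ _ _ h h' => isMul_unique_of hn hPC h h'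
      isMul_assoc := fun _ _ _ _ _ _ _ h₁ h₂ h₃ h₄ => isMul_assoc_of hK2 hn h₁ h₂ h₃ h₄
      isMul_sphere := isMul_sphere_of hK3 hn
      exists_isMul_neg := exists_isMul_neg_of exists_isOrientedConnectedSum_holds hK1 hK4
        (HomotopySphere.nonempty_diffeomorph_of_isHCobordant hS15 h5) (by omega) o₀ }

end HomotopySphereClass

/-- **Kervaire–Milnor's Theorem 1.1 for `Θₙ = HomotopySphereClass n`, `n ≠ 0, 4`, from
manifold-level named facts only.** The named fact `exists_commGroup_homotopySphereClass` (for
`n ≠ 0, 4` the oriented-diffeomorphism classes of homotopy `n`-spheres form an abelian group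
under connected sum with unit `[𝕊ⁿ]` and inverse `[Σ] ↦ [-Σ]`) follows from:
(i) homotopy spheres of dimension `≤ 3` are standard (the smooth Poincaré conjecture in
dimensions `1, 2, 3`: tree fact `SPC4.nonemptyDiffeomorphSphere_of_mem`, spc4.S32; Kervaire–Milnor
1963 p. 507, with Perelman's theorem for `n = 3`);
(iii) sums of homotopy spheres are homotopy spheres
(`HomotopySphere.nonempty_homotopyEquiv_sphere_of_isConnectedSum`; p. 505);
(iv) uniqueness of oriented connected sums
(`exists_diffeomorph_isOrientationPreserving_of_isOrientedConnectedSum`; Lemma 2.1, Palais–Cerf);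
(v) associativity (`isOrientedConnectedSum_assoc`; Lemma 2.1);
(vi) `M # Sⁿ = M` (`isOrientedConnectedSum_sphere_self`; Lemma 2.1);
(vii) `Σ # (-Σ)` is h-cobordant to `Sⁿ`
(`HomotopySphere.isHCobordant_sphere_of_isOrientedConnectedSum_neg`; Lemmas 2.3–2.4);
(viii) the smooth h-cobordism theorem (`SPC4.nonempty_diffeomorph_of_isHCobordant_of_five_le`,
spc4.S15; Smale 1962, Cor. 1.3; Milnor 1965, Thm 9.1; Kervaire–Milnor p. 505).
Everything else in the printed proof (p. 507) — (ii) existence of oriented connected sums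
(`exists_isOrientedConnectedSum_holds`, `OrientedConnectedSumExistence.lean`), well-definedness
on classes, commutativity, the unit being independent of the orientation of `𝕊ⁿ`, simple
connectivity of homotopy spheres, inverses from (vii)–(viii), the group axioms, and the trivial
cases `n ≤ 3` — is proved in `HomotopySpheresProofs.lean`, `HomotopySpheresGroup.lean`,
`OrientedConnectedSumTransportProofs.lean`, `OrientedConnectedSumExistence.lean` and this file.
[cite: KervaireMilnorAnnals1963, Thm. 1.1, §2 pp. 505–507] [cite: Smale1962, Cor. 1.3] -/
theorem exists_commGroup_homotopySphereClass_of_manifoldFacts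
    (hlow : FourManifolds.nonemptyDiffeomorphSphere_of_mem.{0})
    (hK1 : HomotopySphere.nonempty_homotopyEquiv_sphere_of_isConnectedSum)
    (hPC : ∀ (n : ℕ) (S T U U' : HomotopySphere n),
      exists_diffeomorph_isOrientationPreserving_of_isOrientedConnectedSum (IM := 𝓡 n)
        (IN := 𝓡 n) (IP := 𝓡 n) (IP' := 𝓡 n) (M := S.carrier) (N := T.carrier)
        (P := U.carrier) (P' := U'.carrier))
    (hK2 : isOrientedConnectedSum_assoc.{0})
    (hK3 : isOrientedConnectedSum_sphere_self.{0})
    (hK4 : HomotopySphere.isHCobordant_sphere_of_isOrientedConnectedSum_neg)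
    (hS15 : FourManifolds.nonempty_diffeomorph_of_isHCobordant_of_five_le.{0}) :
    exists_commGroup_homotopySphereClass :=
  exists_commGroup_homotopySphereClass_of_groupLawFacts hlow fun _ h5 =>
    HomotopySphereClass.groupLawFacts_of_manifoldFacts h5 hK1 (hPC _) hK2 hK3 hK4 hS15

end Literature.Topology.FourManifolds
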